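import Summits.ABC.StewartYu.ArchG3Setup
import Summits.ABC.StewartYu.GenThreeInductionArch
import Mathlib.Analysis.SpecialFunctions.Log.Basic
import HarnessLib

/-!
# Cell abc-stewartyu, rung A1.L (crux r2 `ArchCoreRat`), parcel WP-L.A P-A4: the LINEAR FORM under the negated bound — `Λ ≠ 0`, and the
# analytic smallness `V₀·|Λ/b_{j₀}|·X ≤ 1` the comparison lemmas consume

`Summits/ABC/StewartYu/ArchG3Lambda.lean` — cell `abc-stewartyu` (seat p5-g7).  Theorems on `ArchG3Setup`; no named fact.  Archimedean twin of
`PadicG3Lambda.lean` (`G3Setup.norm_Λ_div_le_of_padicValRat`): there the analytic smallness `‖Λ/b_{j₀}‖ ≤ p^{−(m+1)}` came from the order of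
`∏α^b − 1`; here the frame works under the NEGATED crux conclusion `log|Λ| < −U` (`U = C(n)·Ω·log(eB)`, Nesterenko (2.14)) directly on the
real linear form `Λ = Σ bⱼ log αⱼ` of the set-up, and every smallness hypothesis of `ArchG3Sizes` / `ArchG3NodeJets`
(`V₀·|Λ/b_{j₀}|·ρ ≤ 1`, the factor `2V₀|Λ/b_{j₀}||x|` of `ε`) is discharged from it.

* `Λ_eq_linearForm`, `Λ_ne_zero` (independent generators, `b ≠ 0`; via `GenThreeInductionArch.linearForm_ne_zero`);
* `abs_Λ_div_le_abs_Λ` (`|b_{j₀}| ≥ 1`), `abs_Λ_le_exp_neg_of_log_le`, **`abs_Λ_div_le_exp_neg`**;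
* **`smallness_of_log_le`**: `log|Λ| ≤ −U`, `V₀·X ≤ e^{U'}`, `U' ≤ U` ⇒ `V₀·|Λ/b_{j₀}|·X ≤ 1`;
* `mul_abs_Λ_div_le_exp` — the size of the comparison factor: `V₀·|Λ/b_{j₀}|·X ≤ e^{U' − U}`.

WHAT THIS IS NOT: no Liouville lower bound (that is `GenThreeBaseArch.liouville_linearForm`, p4); no parameters; no crux moves.

References: Yu. V. Nesterenko, LNM 1819 (2003), §2 (2.14), §4.2 (4.15)–(4.16).
-/

noncomputable section

open Finset

namespace Summit.ABC.StewartYu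

namespace ArchG3Setup

variable (S : ArchG3Setup)

/-- `Λ` is the linear form `Σⱼ bⱼ log αⱼ` of the crux text (definitional unfolding, for rewriting against `CoreArch`).
[cite: Nesterenko2003, §2 (2.2)] -/
theorem Λ_eq_linearForm : S.Λ = ∑ j, (S.b j : ℝ) * Real.log (S.α j : ℝ) := rfl

/-- **`Λ ≠ 0`** for multiplicatively independent generators and `b ≠ 0` (`b_{j₀} ≠ 0` suffices for `b ≠ 0`).
[cite: Nesterenko2003, §2 (Theorem 2.2, hypothesis of linear independence)] -/
theorem Λ_ne_zero (hind : ∀ μ : Fin S.n → ℤ, ∏ j, S.α j ^ μ j = 1 → μ = 0) : S.Λ ≠ 0 := by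
  have hb : S.b ≠ 0 := fun h => S.bj₀_ne (by rw [h]; rfl)
  exact GenThreeInductionArch.linearForm_ne_zero S.α S.α_pos hind S.b hb

/-- `|Λ / b_{j₀}| ≤ |Λ|` (as `|b_{j₀}| ≥ 1`). [folklore] -/
theorem abs_Λ_div_le_abs_Λ : |S.Λ / (S.b S.j₀ : ℝ)| ≤ |S.Λ| := by
  rw [abs_div]
  exact div_le_self (abs_nonneg _) S.one_le_abs_bj₀

/-- Under the negated bound `log|Λ| ≤ −U` with `0 < U`: `|Λ| ≤ e^{−U}` (and `Λ ≠ 0` automatically, as `log 0 = 0`).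
[cite: Nesterenko2003, §2 (2.14)] -/
theorem abs_Λ_le_exp_neg_of_log_le {U : ℝ} (hU : 0 < U) (h : Real.log |S.Λ| ≤ -U) : |S.Λ| ≤ Real.exp (-U) := by
  have hΛ : S.Λ ≠ 0 := by
    intro h0
    rw [h0, abs_zero, Real.log_zero] at h
    linarith
  have hpos : 0 < |S.Λ| := abs_pos.mpr hΛ
  calc |S.Λ| = Real.exp (Real.log |S.Λ|) := (Real.exp_log hpos).symm
    _ ≤ Real.exp (-U) := Real.exp_le_exp.mpr h

/-- **`|Λ / b_{j₀}| ≤ e^{−U}`** under the negated bound. [cite: Nesterenko2003, §2 (2.14), §4.2 (4.15)] -/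
theorem abs_Λ_div_le_exp_neg {U : ℝ} (hU : 0 < U) (h : Real.log |S.Λ| ≤ -U) :
    |S.Λ / (S.b S.j₀ : ℝ)| ≤ Real.exp (-U) :=
  S.abs_Λ_div_le_abs_Λ.trans (S.abs_Λ_le_exp_neg_of_log_le hU h)

/-- **The size of the comparison factor**: `V₀·|Λ/b_{j₀}|·X ≤ e^{U′ − U}` when `log|Λ| ≤ −U` and `V₀·X ≤ e^{U′}`
(the factor `2V₀|Λ/b_{j₀}||x|` of `ArchG3NodeJets`' `ε` is `≤ 2e^{U′−U}`, i.e. the full crux exponent is WON, minus the height of the node).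
[cite: Nesterenko2003, §4.2 (4.15)–(4.16)] -/
theorem mul_abs_Λ_div_le_exp {U U' V₀ X : ℝ} (hU : 0 < U) (h : Real.log |S.Λ| ≤ -U)
    (hVX : V₀ * X ≤ Real.exp U') : V₀ * |S.Λ / (S.b S.j₀ : ℝ)| * X ≤ Real.exp (U' - U) := by
  have h1 := S.abs_Λ_div_le_exp_neg hU h
  calc V₀ * |S.Λ / (S.b S.j₀ : ℝ)| * X = (V₀ * X) * |S.Λ / (S.b S.j₀ : ℝ)| := by ring
    _ ≤ Real.exp U' * Real.exp (-U) := mul_le_mul hVX h1 (abs_nonneg _) (Real.exp_nonneg _)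
    _ = Real.exp (U' - U) := by rw [← Real.exp_add]; ring_nf

/-- **The smallness hypothesis of the comparison lemmas**: `V₀·|Λ/b_{j₀}|·X ≤ 1` as soon as `log|Λ| ≤ −U`, `V₀·X ≤ e^{U′}` and `U′ ≤ U`
(in the frame `U′ = log V₀ + log X_s ≪ U = C(n)Ω log(eB)`). [cite: Nesterenko2003, §4.2 (4.15)] -/
theorem smallness_of_log_le {U U' V₀ X : ℝ} (hU : 0 < U) (h : Real.log |S.Λ| ≤ -U)
    (hVX : V₀ * X ≤ Real.exp U') (hU' : U' ≤ U) : V₀ * |S.Λ / (S.b S.j₀ : ℝ)| * X ≤ 1 := by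
  refine (S.mul_abs_Λ_div_le_exp hU h hVX).trans ?_
  rw [← Real.exp_zero]
  exact Real.exp_le_exp.mpr (by linarith)

end ArchG3Setup

end Summit.ABC.StewartYu

end
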